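import Summits.QuantumFields.BalabanUV.Beta.GAN24.WardResidualRotatedVertexDipole
import Summits.QuantumFields.BalabanUV.Beta.GAN24.BiStencilZeroMode

/-!
# `BalabanUV.Beta.GAN24.WardResidualRotatedVertexMass` — binder row G-an2-4 ∕ (CONV-C), CT-W route «WC-TL» → «QR-LL», the OWNER gan24-p1 g26's CHARGE AUDIT,
# σ-piece (α): **THE ZEROTH SLOT-MOMENT OF THE ROTATED-VERTEX LETTER VANISHES, BY BLOCK COVARIANCE ALONE** — the (M0_y) hypothesis of leaf-01 g63's
# (LT-3) `LayerPushMoments` (OWNER W11 (2)) discharged for the (α) piece (road-P2 chair `b2b-balaban-gan24-p2`, gen 38, INTENT 3)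

NOT IN PRINT; OUR BOOKKEEPING ([folklore] `tsum` bookkeeping over the tree's translation laws `AxialDressingRootedBmHessian.shiftK_coDressKBmAt_KInvStep`,
`SpineRecursiveW.SpureRecAt_translate`, `SpineRootedW2.M1At_translate`, leaf-06's `KernelLegCharges.tsum_prod_shiftK ∕ summable_weight_mul_kernel` and leaf-02's
`BiStencilZeroMode.tsum_eq_sum_box_tsum` BY NAME; 0 `def`, 0 cited fact, 0 `def … : Prop`, 0 sorry).  HONEST FRAMING (cell contract, verbatim): «discharging `BetaPertH`
makes Bałaban's UV stability UNCONDITIONAL — a real constructive-QFT result; it is NOT the continuum limit and NOT the Clay problem.»  HONEST DEPENDENCY (verbatim):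
«continuum YM on T⁴ ⇐ BetaPertH ∧ nine spine estimates (0/9 proved); BetaPertH ⇐ (D1) ∧ (D4) ∧ CAP+tail; G-an2-4 gates asym, D1 and NE2/3/4.»

WHAT.  With `V(y′)` = the live charge of (α) = `½ • dM([G_{j+1}, X_y]) S_{j+1} M1_{j+1}` at slot `(ν, y′)`, channel `(a,b)` (the value displayed by
`WardResidualRotatedVertex.hasSum_prod_rotatedVertex_comb`):
* §1 block covariance in the tree's currency: `pairCharge_SpureRecAt_block` (`Z_S(κ, Lc•t + v) = Z_S(κ, Lc•y + v)`), `pairCharge_M1At_const` (`Z_M(ρ′, w) = Z_M(ρ′, y)`),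
  `colH_comb_block` (`colH G ν y κ (Lc•t + v) = colH G ν (y + (y − t)) κ (Lc•y + v)`), `colM_comb_coarse` (`colM G ν y ρ′ w = colM G ν (y + (y − w)) ρ′ y`).
* §2 «COLUMN TOTAL = BLOCK SUM OF ROW TOTALS» (idea-1 g35 (4.9)): **`tsum_colH_pairCharge_eq_blockSum`** `Σ'_u colH G ν y κ u·Z_S(κ,u) = Σ_{v∈box} (Σ'_{y′} colH G ν y′ κ (Lc•y+v))·Z_S(κ, Lc•y+v)`,
  **`tsum_colM_pairCharge_eq`** `Σ'_w colM G ν y ρ′ w·Z_M(ρ′,w) = (Σ'_{y′} colM G ν y′ ρ′ y)·Z_M(ρ′,y)`.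
* §3 `charge_term_eq` (the slot profile of `V`: `V(y′) = 𝟙[y′=y]·V₀ − ¼·[block term at y′]`) and **`hasSum_rotatedVertex_totalCharge_comb`**: `HasSum (y′ ↦ V(y′)) 0` —
  THE TOTAL OVER THE SLOTS OF (α)'s LIVE CHARGE IS ZERO, for every label `y`, slot direction `ν`, channel `(a,b)`, level `j+1`, in-block root (E15 (iii): `M0 = 0` to 1e-12).
* §4 **`hasSum_slotMoment_rotatedVertex_comb_labelFree`**: the slot-DIPOLE (INTENT 2's value) is LABEL-FREE — `= −¼·[Σ_κ Σ_{v∈box} 𝔤^{FM}_{κν,λ}(v)·Z_S(κ,v) + Σ_ρ′ 𝔤^{MM}_{ρ′ν,λ}·Z_M(ρ′,0)]`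
  with `𝔤^{FM}(v) = Σ'_t t_λ·colH G_{j+1} ν t κ v`, `𝔤^{MM} = Σ'_t t_λ·colM G_{j+1} ν t ρ′ 0` (idea-1 (4.9)'s first moments of ONE coarse column — the only `G`-dependent factors).
Asserts NO value of Bałaban's tables; discharges NOTHING of (Q-R) ∕ (LT) ∕ (Q-L) ∕ (C) ∕ «T2Shape» ∕ «T2Drift» ∕ (hW, hWall) — (M0) is ONE displayed hypothesis of (LT-3) for ONE piece;
NEVER «G-an2-4 closed» as (CONV-C); NOT D1, NOT BetaPertH, NOT continuum, NOT Clay.  2026-08-22; no existing file touched.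
-/

noncomputable section

open Finset
open scoped BigOperators
open Literature.MathematicalPhysics.QuantumFieldTheory
open Literature.MathematicalPhysics.QuantumFieldTheory.Balaban1983to89
open Literature.MathematicalPhysics.QuantumFieldTheory.Balaban1983to89.Beta
open B12Sec2to5 (l1)
open ExpKernelCalculus (Site MKer BiLoc Decays VertexFamily shiftK)
open AffineAveraging (box toSite)
open AveragingContours (blk)
open OneStepResolventKernel (Fib LocStencil)
open OneStepKernelFamily (KInvStep colH abs_colH_le)
open SecondOrderResponse (colM dM abs_colM_le)
open Summit.QuantumFields.BalabanUV.Beta.BorderedHessian (diagK)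
open Summit.QuantumFields.BalabanUV.Beta.ChartConjugation (conjV)
open Summit.QuantumFields.BalabanUV.Beta.AveragingWardRootedStencils (legInd)
open Summit.QuantumFields.BalabanUV.Beta.AxialDressingRooted (coDressKBmAt decays_coDressKBmAt_KInvStep shiftK_coDressKBmAt_KInvStep)
open Summit.QuantumFields.BalabanUV.Beta.SpineRooted (SpureRecAt M1At locStencil_SpureRecAt vertexFamily_M1At SpureRecAt_translate M1At_translate)
open Summit.QuantumFields.BalabanUV.Beta.GAN24.KernelLegCharges (tsum_prod_shiftK summable_weight_mul_kernel summable_exp_coarse)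
open Summit.QuantumFields.BalabanUV.Beta.GAN24.ResolventLegCharges (summable_exp_coarse')
open Summit.QuantumFields.BalabanUV.Beta.GAN24.BiStencilZeroMode (tsum_eq_sum_box_tsum)
open Summit.QuantumFields.BalabanUV.Beta.GAN24.WardResidualRotatedVertex (hasSum_prod_rotatedVertex_comb)
open Summit.QuantumFields.BalabanUV.Beta.GAN24.WardResidualRotatedVertexDipole (tsum_ite_blk_eq)

namespace Summit.QuantumFields.BalabanUV.Beta.GAN24.WardResidualRotatedVertexMass

variable {d Lc : ℕ} [NeZero Lc]

/-! ## §1 Block covariance of the comb objects, in the currency of pair charges and coarse columns -/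

/-- [folklore] The pair charge of the comb S-slot letter is constant along the block orbit: `Z_S(κ, Lc•t + v) = Z_S(κ, Lc•y + v)` (`SpureRecAt_translate` + `tsum_prod_shiftK`). -/
theorem pairCharge_SpureRecAt_block (hLc : 1 ≤ Lc) (ρ : Fin (d + 1) → ℤ) (cE cVH cΛ : ℝ) (j : ℕ) (κ : Fin (d + 1)) (v : Fin (d + 1) → ℕ)
    (y t : Site (d + 1)) (a b : Fib d) :
    ∑' xz : Site (d + 1) × Site (d + 1), SpureRecAt d Lc ρ cE cVH cΛ j κ ((Lc : ℤ) • t + toSite v) xz.1 xz.2 a b =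
      ∑' xz : Site (d + 1) × Site (d + 1), SpureRecAt d Lc ρ cE cVH cΛ j κ ((Lc : ℤ) • y + toSite v) xz.1 xz.2 a b := by
  have e : (Lc : ℤ) • t + toSite v = ((Lc : ℤ) • y + toSite v) + (Lc : ℤ) • (t - y) := by
    rw [smul_sub]; abel
  rw [e, SpureRecAt_translate ρ hLc cE cVH cΛ j κ _ (t - y), tsum_prod_shiftK]

omit [NeZero Lc] in
/-- [folklore] The pair charge of the mixed letter is slot-free: `Z_M(ρ′, w) = Z_M(ρ′, y)` (`M1At_translate` + `tsum_prod_shiftK`). -/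
theorem pairCharge_M1At_const (ρ : Fin (d + 1) → ℤ) (cΛ : ℝ) (j : ℕ) (ρ' : Fin (d + 1)) (w y : Site (d + 1)) (a b : Fib d) :
    ∑' xz : Site (d + 1) × Site (d + 1), M1At d Lc ρ cΛ j ρ' w xz.1 xz.2 a b =
      ∑' xz : Site (d + 1) × Site (d + 1), M1At d Lc ρ cΛ j ρ' y xz.1 xz.2 a b := by
  have e : w = y + (w - y) := by abel
  rw [e, M1At_translate ρ cΛ j ρ' y (w - y), tsum_prod_shiftK]

/-- [folklore] The field rows of the coarse column of the comb kernel along a block orbit: `colH G ν y κ (Lc•t + v) = colH G ν (y + (y − t)) κ (Lc•y + v)`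
(`shiftK_coDressKBmAt_KInvStep` at the translation `t − y`). -/
theorem colH_comb_block (ρ : Fin (d + 1) → ℤ) (j : ℕ) (ν κ : Fin (d + 1)) (v : Fin (d + 1) → ℕ) (y t : Site (d + 1)) :
    colH (coDressKBmAt ρ Lc (KInvStep (d := d) Lc j)) Lc ν y κ ((Lc : ℤ) • t + toSite v) =
      colH (coDressKBmAt ρ Lc (KInvStep (d := d) Lc j)) Lc ν (y + (y - t)) κ ((Lc : ℤ) • y + toSite v) := by
  have h := shiftK_coDressKBmAt_KInvStep (d := d) (Lc := Lc) ρ j (t - y)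
  have h1 := congrFun (congrFun (congrFun (congrFun h ((Lc : ℤ) • t + toSite v)) ((Lc : ℤ) • y)) (Sum.inl κ)) (Sum.inr ν)
  rw [shiftK] at h1
  simp only [colH]; rw [← h1]
  congr 1 <;> [(simp only [smul_sub]; abel); (simp only [smul_add, smul_sub]; abel)]

/-- [folklore] The multiplier rows of the coarse column of the comb kernel: `colM G ν y ρ′ w = colM G ν (y + (y − w)) ρ′ y`. -/
theorem colM_comb_coarse (ρ : Fin (d + 1) → ℤ) (j : ℕ) (ν ρ' : Fin (d + 1)) (y w : Site (d + 1)) :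
    colM (coDressKBmAt ρ Lc (KInvStep (d := d) Lc j)) Lc ν y ρ' w =
      colM (coDressKBmAt ρ Lc (KInvStep (d := d) Lc j)) Lc ν (y + (y - w)) ρ' y := by
  have h := shiftK_coDressKBmAt_KInvStep (d := d) (Lc := Lc) ρ j (w - y)
  have h1 := congrFun (congrFun (congrFun (congrFun h ((Lc : ℤ) • w)) ((Lc : ℤ) • y)) (Sum.inr ρ')) (Sum.inr ν)
  rw [shiftK] at h1
  simp only [colM]; rw [← h1]
  congr 1 <;> [(simp only [smul_sub]; abel); (simp only [smul_add, smul_sub]; abel)]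

/-! ## §2 «Column total = block sum of row totals» -/

omit [NeZero Lc] in
/-- [folklore] Summability of a decaying column against the (bounded-by-locality) pair charges of a local stencil family (leaf-06's joint summability, fibre-summed). -/
theorem summable_colH_mul_pairCharge {K : MKer (d + 1) (Fib d)} {C δ : ℝ} (hK : Decays K C δ) (hδ : 0 < δ) (ν : Fin (d + 1)) (y : Site (d + 1))
    {S : Fin (d + 1) → Site (d + 1) → MKer (d + 1) (Fib d)} {Cs δs : ℝ} (hS : LocStencil S Cs δs) (hδs : 0 < δs) (κ : Fin (d + 1)) (a b : Fib d) :
    Summable fun u : Site (d + 1) => colH K Lc ν y κ u * ∑' xz : Site (d + 1) × Site (d + 1), S κ u xz.1 xz.2 a b := by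
  have h1 : ∀ t : Site (d + 1), ((1 : ℕ) : ℤ) • t = t := fun t => by simp
  have hw : ∀ t : Site (d + 1), |colH K Lc ν y κ t| ≤ C * Real.exp (-δ * l1 (((1 : ℕ) : ℤ) • t - (Lc : ℤ) • y)) := fun t => by
    rw [h1]; exact abs_colH_le (N := Lc) hK ν y κ t
  have hQ : ∀ t : Site (d + 1), BiLoc (S κ t) (((1 : ℕ) : ℤ) • t) (((1 : ℕ) : ℤ) • t) Cs δs := fun t => by rw [h1]; exact hS κ t
  have hs := (summable_weight_mul_kernel (N := 1) le_rfl hw hδ hQ hδs a b).prod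
  refine hs.congr fun u => ?_
  show ∑' c : Site (d + 1) × Site (d + 1), colH K Lc ν y κ u * S κ u c.1 c.2 a b = _
  exact tsum_mul_left

/-- NOT IN PRINT; OUR BOOKKEEPING (idea-1 g35 (4.9) «column total = block-sum of row totals by TI», typed).  For the comb kernel `G = coDressKBmAt ρ Lc (KInvStep Lc j)` and
the comb S-slot `S = SpureRecAt …`:  `Σ'_u colH G ν y κ u · Z_S(κ,u) = Σ_{v∈box} (Σ'_{y′} colH G ν y′ κ (Lc•y + v)) · Z_S(κ, Lc•y + v)` — cell decomposition of the `u`-sum, block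
covariance of both factors, and the slot reflection `t ↦ y + (y − t)`. -/
theorem tsum_colH_pairCharge_eq_blockSum (hLc : 1 ≤ Lc) {r : Fin (d + 1) → ℕ} (hr : r ∈ box (d + 1) Lc) (cE cVH cΛ : ℝ) (j j' : ℕ)
    (ν κ : Fin (d + 1)) (y : Site (d + 1)) (a b : Fib d) :
    ∑' u : Site (d + 1), colH (coDressKBmAt (toSite r) Lc (KInvStep (d := d) Lc j)) Lc ν y κ u
        * ∑' xz : Site (d + 1) × Site (d + 1), SpureRecAt d Lc (toSite r) cE cVH cΛ j' κ u xz.1 xz.2 a b =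
      ∑ v ∈ box (d + 1) Lc, (∑' y' : Site (d + 1), colH (coDressKBmAt (toSite r) Lc (KInvStep (d := d) Lc j)) Lc ν y' κ ((Lc : ℤ) • y + toSite v))
        * ∑' xz : Site (d + 1) × Site (d + 1), SpureRecAt d Lc (toSite r) cE cVH cΛ j' κ ((Lc : ℤ) • y + toSite v) xz.1 xz.2 a b := by
  obtain ⟨δG, CG, hδG, hCG, hG⟩ := decays_coDressKBmAt_KInvStep (d := d) hr j
  obtain ⟨Cs, δs, hδs, hS⟩ := locStencil_SpureRecAt (d := d) (Lc := Lc) hLc hr cE cVH cΛ j'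
  rw [tsum_eq_sum_box_tsum (N := Lc) (summable_colH_mul_pairCharge hG hδG ν y hS hδs κ a b)]
  refine Finset.sum_congr rfl fun v _ => ?_
  have e : ∀ t : Site (d + 1), colH (coDressKBmAt (toSite r) Lc (KInvStep (d := d) Lc j)) Lc ν y κ ((Lc : ℤ) • t + toSite v)
      * ∑' xz : Site (d + 1) × Site (d + 1), SpureRecAt d Lc (toSite r) cE cVH cΛ j' κ ((Lc : ℤ) • t + toSite v) xz.1 xz.2 a b =
      colH (coDressKBmAt (toSite r) Lc (KInvStep (d := d) Lc j)) Lc ν (y + (y - t)) κ ((Lc : ℤ) • y + toSite v)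
      * ∑' xz : Site (d + 1) × Site (d + 1), SpureRecAt d Lc (toSite r) cE cVH cΛ j' κ ((Lc : ℤ) • y + toSite v) xz.1 xz.2 a b := fun t => by
    rw [colH_comb_block, pairCharge_SpureRecAt_block hLc]
  simp only [e]
  rw [tsum_mul_right]
  congr 1
  have hre := (Equiv.subLeft (y + y)).tsum_eq (fun y' : Site (d + 1) => colH (coDressKBmAt (toSite r) Lc (KInvStep (d := d) Lc j)) Lc ν y' κ ((Lc : ℤ) • y + toSite v))
  rw [← hre]
  exact tsum_congr fun t => by rw [Equiv.subLeft_apply, add_sub_assoc]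

omit [NeZero Lc] in
/-- NOT IN PRINT; OUR BOOKKEEPING.  The multiplier twin: `Σ'_w colM G ν y ρ′ w · Z_M(ρ′,w) = (Σ'_{y′} colM G ν y′ ρ′ y) · Z_M(ρ′,y)` (`M1At_translate`, `shiftK_coDressKBmAt_KInvStep`). -/
theorem tsum_colM_pairCharge_eq [NeZero Lc] (r : Fin (d + 1) → ℕ) (cΛ : ℝ) (j j' : ℕ) (ν ρ' : Fin (d + 1)) (y : Site (d + 1)) (a b : Fib d) :
    ∑' w : Site (d + 1), colM (coDressKBmAt (toSite r) Lc (KInvStep (d := d) Lc j)) Lc ν y ρ' w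
        * ∑' xz : Site (d + 1) × Site (d + 1), M1At d Lc (toSite r) cΛ j' ρ' w xz.1 xz.2 a b =
      (∑' y' : Site (d + 1), colM (coDressKBmAt (toSite r) Lc (KInvStep (d := d) Lc j)) Lc ν y' ρ' y)
        * ∑' xz : Site (d + 1) × Site (d + 1), M1At d Lc (toSite r) cΛ j' ρ' y xz.1 xz.2 a b := by
  have e : ∀ w : Site (d + 1), colM (coDressKBmAt (toSite r) Lc (KInvStep (d := d) Lc j)) Lc ν y ρ' w
      * ∑' xz : Site (d + 1) × Site (d + 1), M1At d Lc (toSite r) cΛ j' ρ' w xz.1 xz.2 a b =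
      colM (coDressKBmAt (toSite r) Lc (KInvStep (d := d) Lc j)) Lc ν (y + (y - w)) ρ' y
      * ∑' xz : Site (d + 1) × Site (d + 1), M1At d Lc (toSite r) cΛ j' ρ' y xz.1 xz.2 a b := fun w => by
    rw [colM_comb_coarse, pairCharge_M1At_const (toSite r) cΛ j' ρ' w y]
  simp only [e]
  rw [tsum_mul_right]
  congr 1
  have hre := (Equiv.subLeft (y + y)).tsum_eq (fun y' : Site (d + 1) => colM (coDressKBmAt (toSite r) Lc (KInvStep (d := d) Lc j)) Lc ν y' ρ' y)
  rw [← hre]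
  exact tsum_congr fun t => by rw [Equiv.subLeft_apply, add_sub_assoc]

/-! ## §3 The slot profile of `V` and the vanishing of its total -/

omit [NeZero Lc] in
/-- [folklore] THE SLOT PROFILE OF THE (α) CHARGE (ANY kernel `G` with summable column × charge, ANY charge tables): `V(y′) = 𝟙[y′ = y]·V₀ − ¼·[block term at y′]`,
`V₀ = ¼·[Σ_κ Σ'_u colH G ν y κ u·Z_S κ u + Σ_ρ′ Σ'_w colM G ν y ρ′ w·Z_M ρ′ w]` — a DELTA at the diagonal slot minus the decaying block term. -/
theorem charge_term_eq (hLc : 1 ≤ Lc) (G : MKer (d + 1) (Fib d)) (ZS ZM : Fin (d + 1) → Site (d + 1) → ℝ) (y : Site (d + 1)) (ν : Fin (d + 1))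
    (hsum : ∀ κ, Summable fun u : Site (d + 1) => colH G Lc ν y κ u * ZS κ u)
    (hsumM : ∀ ρ', Summable fun w : Site (d + 1) => colM G Lc ν y ρ' w * ZM ρ' w) (y' : Site (d + 1)) :
    (1 / 2 : ℝ) *
        ((∑ κ : Fin (d + 1), ∑' u : Site (d + 1),
            colH G Lc ν y' κ u * ((if y' = y then (1 / 2 : ℝ) else 0) - (if blk Lc u = y then (1 / 2 : ℝ) else 0)) * ZS κ u)
          + ∑ ρ' : Fin (d + 1), ∑' w : Site (d + 1),
            colM G Lc ν y' ρ' w * ((if y' = y then (1 / 2 : ℝ) else 0) - (if w = y then (1 / 2 : ℝ) else 0)) * ZM ρ' w) =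
      (if y' = y then (1 / 4 : ℝ) * ((∑ κ : Fin (d + 1), ∑' u : Site (d + 1), colH G Lc ν y κ u * ZS κ u)
          + ∑ ρ' : Fin (d + 1), ∑' w : Site (d + 1), colM G Lc ν y ρ' w * ZM ρ' w) else 0)
        - (1 / 4 : ℝ) * ((∑ κ : Fin (d + 1), ∑ v ∈ box (d + 1) Lc, colH G Lc ν y' κ ((Lc : ℤ) • y + toSite v) * ZS κ ((Lc : ℤ) • y + toSite v))
          + ∑ ρ' : Fin (d + 1), colM G Lc ν y' ρ' y * ZM ρ' y) := by
  classical
  -- the block term (any y′): the `u`-sum of the block indicator collapses, the `w`-sum is a single point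
  have hB : ∀ κ : Fin (d + 1), (∑' u : Site (d + 1), colH G Lc ν y' κ u * (if blk Lc u = y then (1 / 2 : ℝ) else 0) * ZS κ u)
      = (1 / 2 : ℝ) * ∑ v ∈ box (d + 1) Lc, colH G Lc ν y' κ ((Lc : ℤ) • y + toSite v) * ZS κ ((Lc : ℤ) • y + toSite v) := by
    intro κ
    have e := tsum_ite_blk_eq hLc y (fun u => (1 / 2 : ℝ) * (colH G Lc ν y' κ u * ZS κ u))
    rw [Finset.mul_sum, ← e]
    refine tsum_congr fun u => ?_
    split_ifs <;> ring
  have hBM : ∀ ρ' : Fin (d + 1), (∑' w : Site (d + 1), colM G Lc ν y' ρ' w * (if w = y then (1 / 2 : ℝ) else 0) * ZM ρ' w)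
      = (1 / 2 : ℝ) * (colM G Lc ν y' ρ' y * ZM ρ' y) := by
    intro ρ'
    rw [tsum_eq_single y (fun w hw => by rw [if_neg hw, mul_zero, zero_mul])]
    rw [if_pos rfl]; ring
  by_cases hy : y' = y
  · subst hy
    simp only [if_true]
    have hA : ∀ κ : Fin (d + 1), (∑' u : Site (d + 1), colH G Lc ν y' κ u * ((1 / 2 : ℝ) - (if blk Lc u = y' then (1 / 2 : ℝ) else 0)) * ZS κ u)
        = (1 / 2 : ℝ) * (∑' u : Site (d + 1), colH G Lc ν y' κ u * ZS κ u)
          - (1 / 2 : ℝ) * ∑ v ∈ box (d + 1) Lc, colH G Lc ν y' κ ((Lc : ℤ) • y' + toSite v) * ZS κ ((Lc : ℤ) • y' + toSite v) := by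
      intro κ
      rw [← hB κ, ← tsum_mul_left, ← ((hsum κ).mul_left (1 / 2 : ℝ)).tsum_sub]
      · exact tsum_congr fun u => by ring
      · refine Summable.of_norm_bounded ((hsum κ).mul_left (1 / 2 : ℝ)).abs (fun u => ?_)
        rw [Real.norm_eq_abs]
        split_ifs
        · rw [abs_mul, abs_mul, abs_mul]
          exact le_of_eq (by rw [abs_mul]; ring)
        · rw [mul_zero, zero_mul, abs_zero]; exact abs_nonneg _
    have hAM : ∀ ρ' : Fin (d + 1), (∑' w : Site (d + 1), colM G Lc ν y' ρ' w * ((1 / 2 : ℝ) - (if w = y' then (1 / 2 : ℝ) else 0)) * ZM ρ' w)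
        = (1 / 2 : ℝ) * (∑' w : Site (d + 1), colM G Lc ν y' ρ' w * ZM ρ' w) - (1 / 2 : ℝ) * (colM G Lc ν y' ρ' y' * ZM ρ' y') := by
      intro ρ'
      rw [← hBM ρ', ← tsum_mul_left, ← ((hsumM ρ').mul_left (1 / 2 : ℝ)).tsum_sub]
      · exact tsum_congr fun w => by ring
      · refine Summable.of_norm_bounded ((hsumM ρ').mul_left (1 / 2 : ℝ)).abs (fun w => ?_)
        rw [Real.norm_eq_abs]
        split_ifs
        · rw [abs_mul, abs_mul, abs_mul]
          exact le_of_eq (by rw [abs_mul]; ring)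
        · rw [mul_zero, zero_mul, abs_zero]; exact abs_nonneg _
    simp only [hA, hAM, Finset.sum_sub_distrib, ← Finset.mul_sum]
    ring
  · simp only [if_neg hy, zero_sub]
    have hA : ∀ κ : Fin (d + 1), (∑' u : Site (d + 1), colH G Lc ν y' κ u * (-(if blk Lc u = y then (1 / 2 : ℝ) else 0)) * ZS κ u)
        = -((1 / 2 : ℝ) * ∑ v ∈ box (d + 1) Lc, colH G Lc ν y' κ ((Lc : ℤ) • y + toSite v) * ZS κ ((Lc : ℤ) • y + toSite v)) := by
      intro κ
      rw [← hB κ, ← tsum_neg]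
      exact tsum_congr fun u => by ring
    have hAM : ∀ ρ' : Fin (d + 1), (∑' w : Site (d + 1), colM G Lc ν y' ρ' w * (-(if w = y then (1 / 2 : ℝ) else 0)) * ZM ρ' w)
        = -((1 / 2 : ℝ) * (colM G Lc ν y' ρ' y * ZM ρ' y)) := by
      intro ρ'
      rw [← hBM ρ', ← tsum_neg]
      exact tsum_congr fun w => by ring
    simp only [hA, hAM, Finset.sum_neg_distrib, ← Finset.mul_sum]
    ring

/-- NOT IN PRINT; OUR BOOKKEEPING.  **THE ZEROTH SLOT-MOMENT OF (α) VANISHES** — the (M0_y) hypothesis of (LT-3) `LayerPushMoments` (OWNER W11 (2)) for the piece (α),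
BY BLOCK COVARIANCE ALONE: for `G_{j+1} = coDressKBmAt ρ Lc (KInvStep Lc (j+1))`, `S = SpureRecAt … (j+1)`, `M = M1At … (j+1)`, the block generator `X_y` of an in-block root,
every slot direction `ν` and channel `(a,b)`:  `HasSum (y′ ↦ Σ'_{(x,z)} (½ • dM (conjV G_{j+1} X_y) Lc S M ν y′) x z a b) 0` — stated on the value `V(y′)` displayed by
`WardResidualRotatedVertex.hasSum_prod_rotatedVertex_comb`.  Mechanism: the delta at the diagonal slot carries `V₀ = ¼·[column total]`, the block term sums over the slots to
`¼·[block sum of row totals]`, and §2 identifies the two.  (E15 (iii): `M0((α)) = 0` to 1e-12 at D = 2.)  The FIRST moment does NOT vanish in general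
(`WardResidualRotatedVertexDipole.hasSum_slotMoment_rotatedVertex_comb` displays it). -/
theorem hasSum_rotatedVertex_totalCharge_comb (hLc : 1 ≤ Lc) {r : Fin (d + 1) → ℕ} (hr : r ∈ box (d + 1) Lc) (cE cVH cΛ : ℝ) (j : ℕ)
    (y : Fin (d + 1) → ℤ) (ν : Fin (d + 1)) (a b : Fib d) :
    HasSum (fun y' : Site (d + 1) =>
        (1 / 2 : ℝ) *
          ((∑ κ : Fin (d + 1), ∑' u : Site (d + 1),
              colH (coDressKBmAt (toSite r) Lc (KInvStep (d := d) Lc (j + 1))) Lc ν y' κ u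
                * ((if y' = y then (1 / 2 : ℝ) else 0) - (if blk Lc u = y then (1 / 2 : ℝ) else 0))
                * ∑' xz : Site (d + 1) × Site (d + 1), SpureRecAt d Lc (toSite r) cE cVH cΛ (j + 1) κ u xz.1 xz.2 a b)
            + ∑ ρ' : Fin (d + 1), ∑' w : Site (d + 1),
              colM (coDressKBmAt (toSite r) Lc (KInvStep (d := d) Lc (j + 1))) Lc ν y' ρ' w
                * ((if y' = y then (1 / 2 : ℝ) else 0) - (if w = y then (1 / 2 : ℝ) else 0))
                * ∑' xz : Site (d + 1) × Site (d + 1), M1At d Lc (toSite r) cΛ (j + 1) ρ' w xz.1 xz.2 a b)) 0 := by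
  classical
  obtain ⟨δG, CG, hδG, hCG, hG⟩ := decays_coDressKBmAt_KInvStep (d := d) hr (j + 1)
  obtain ⟨Cs, δs, hδs, hS⟩ := locStencil_SpureRecAt (d := d) (Lc := Lc) hLc hr cE cVH cΛ (j + 1)
  set G := coDressKBmAt (toSite r) Lc (KInvStep (d := d) Lc (j + 1)) with hGdef
  -- the pair charges as slot functions
  set ZS : Fin (d + 1) → Site (d + 1) → ℝ := fun κ u =>
    ∑' xz : Site (d + 1) × Site (d + 1), SpureRecAt d Lc (toSite r) cE cVH cΛ (j + 1) κ u xz.1 xz.2 a b with hZS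
  set ZM : Fin (d + 1) → Site (d + 1) → ℝ := fun ρ' w =>
    ∑' xz : Site (d + 1) × Site (d + 1), M1At d Lc (toSite r) cΛ (j + 1) ρ' w xz.1 xz.2 a b with hZM
  have hsum : ∀ κ, Summable fun u : Site (d + 1) => colH G Lc ν y κ u * ZS κ u := fun κ =>
    summable_colH_mul_pairCharge hG hδG ν y hS hδs κ a b
  have hZMc : ∀ ρ' w, ZM ρ' w = ZM ρ' y := fun ρ' w => pairCharge_M1At_const (toSite r) cΛ (j + 1) ρ' w y a b
  have hsumM : ∀ ρ', Summable fun w : Site (d + 1) => colM G Lc ν y ρ' w * ZM ρ' w := fun ρ' => by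
    simp only [hZMc ρ']
    refine Summable.of_norm_bounded ((summable_exp_coarse (d := d) hLc hδG ((Lc : ℤ) • y)).mul_left (CG * |ZM ρ' y|)) (fun w => ?_)
    rw [Real.norm_eq_abs, abs_mul]
    calc |colM G Lc ν y ρ' w| * |ZM ρ' y| ≤ (CG * Real.exp (-δG * l1 ((Lc : ℤ) • w - (Lc : ℤ) • y))) * |ZM ρ' y| :=
          mul_le_mul_of_nonneg_right (abs_colM_le (N := Lc) hG ν y ρ' w) (abs_nonneg _)
      _ = CG * |ZM ρ' y| * Real.exp (-δG * l1 ((Lc : ℤ) • w - (Lc : ℤ) • y)) := by ring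
  -- the slot profile
  have hprof := fun y' => charge_term_eq hLc G ZS ZM y ν hsum hsumM y'
  -- the total of the delta term and of the block term
  set V₀ : ℝ := (1 / 4 : ℝ) * ((∑ κ : Fin (d + 1), ∑' u : Site (d + 1), colH G Lc ν y κ u * ZS κ u)
      + ∑ ρ' : Fin (d + 1), ∑' w : Site (d + 1), colM G Lc ν y ρ' w * ZM ρ' w) with hV₀
  have hδslot : HasSum (fun y' : Site (d + 1) => if y' = y then V₀ else 0) V₀ := hasSum_ite_eq y V₀
  have hH : ∀ (κ : Fin (d + 1)) (v : Fin (d + 1) → ℕ), HasSum (fun y' : Site (d + 1) =>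
      colH G Lc ν y' κ ((Lc : ℤ) • y + toSite v) * ZS κ ((Lc : ℤ) • y + toSite v))
      ((∑' y' : Site (d + 1), colH G Lc ν y' κ ((Lc : ℤ) • y + toSite v)) * ZS κ ((Lc : ℤ) • y + toSite v)) := by
    intro κ v
    refine (Summable.hasSum ?_).mul_right _
    refine Summable.of_norm_bounded ((summable_exp_coarse' (d := d) hLc hδG ((Lc : ℤ) • y + toSite v)).mul_left CG) (fun y' => ?_)
    rw [Real.norm_eq_abs]
    exact abs_colH_le (N := Lc) hG ν y' κ _
  have hM : ∀ ρ' : Fin (d + 1), HasSum (fun y' : Site (d + 1) => colM G Lc ν y' ρ' y * ZM ρ' y)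
      ((∑' y' : Site (d + 1), colM G Lc ν y' ρ' y) * ZM ρ' y) := by
    intro ρ'
    refine (Summable.hasSum ?_).mul_right _
    refine Summable.of_norm_bounded ((summable_exp_coarse' (d := d) hLc hδG ((Lc : ℤ) • y)).mul_left CG) (fun y' => ?_)
    rw [Real.norm_eq_abs]
    exact abs_colM_le (N := Lc) hG ν y' ρ' y
  have hblock := ((hasSum_sum (s := (Finset.univ : Finset (Fin (d + 1)))) fun κ _ =>
      hasSum_sum (s := box (d + 1) Lc) fun v _ => hH κ v).add
    (hasSum_sum (s := (Finset.univ : Finset (Fin (d + 1)))) fun ρ' _ => hM ρ')).mul_left (1 / 4 : ℝ)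
  have htot := hδslot.sub hblock
  -- the two totals agree: column total = block sum of row totals (§2)
  have hval : V₀ - (1 / 4 : ℝ) * ((∑ κ : Fin (d + 1), ∑ v ∈ box (d + 1) Lc,
        (∑' y' : Site (d + 1), colH G Lc ν y' κ ((Lc : ℤ) • y + toSite v)) * ZS κ ((Lc : ℤ) • y + toSite v))
      + ∑ ρ' : Fin (d + 1), (∑' y' : Site (d + 1), colM G Lc ν y' ρ' y) * ZM ρ' y) = 0 := by
    rw [hV₀]
    have h1 : ∀ κ : Fin (d + 1), (∑' u : Site (d + 1), colH G Lc ν y κ u * ZS κ u)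
        = ∑ v ∈ box (d + 1) Lc, (∑' y' : Site (d + 1), colH G Lc ν y' κ ((Lc : ℤ) • y + toSite v)) * ZS κ ((Lc : ℤ) • y + toSite v) :=
      fun κ => tsum_colH_pairCharge_eq_blockSum hLc hr cE cVH cΛ (j + 1) (j + 1) ν κ y a b
    have h2 : ∀ ρ' : Fin (d + 1), (∑' w : Site (d + 1), colM G Lc ν y ρ' w * ZM ρ' w)
        = (∑' y' : Site (d + 1), colM G Lc ν y' ρ' y) * ZM ρ' y :=
      fun ρ' => tsum_colM_pairCharge_eq r cΛ (j + 1) (j + 1) ν ρ' y a b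
    simp only [h1, h2]
    ring
  rw [hval] at htot
  refine htot.congr_fun fun y' => ?_
  rw [hprof y']

/-! ## §4 The slot-dipole of (α) is label-free -/

/-- [folklore] The first slot-moment of the field rows of a coarse column of the comb kernel on the label block does not depend on the label:
`Σ'_{y′} (y′−y)_λ·colH G_j Lc ν y′ κ (Lc•y + v) = Σ'_t t_λ·colH G_j Lc ν t κ v` (re-centre `y′ = y + t`, `shiftK_coDressKBmAt_KInvStep` at the translation `y`). -/
theorem tsum_slotMoment_colH_labelFree (ρ : Fin (d + 1) → ℤ) (j : ℕ) (ν κ lam : Fin (d + 1)) (v : Fin (d + 1) → ℕ) (y : Site (d + 1)) :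
    ∑' y' : Site (d + 1), (((y' lam : ℤ) : ℝ) - ((y lam : ℤ) : ℝ)) * colH (coDressKBmAt ρ Lc (KInvStep (d := d) Lc j)) Lc ν y' κ ((Lc : ℤ) • y + toSite v) =
      ∑' t : Site (d + 1), ((t lam : ℤ) : ℝ) * colH (coDressKBmAt ρ Lc (KInvStep (d := d) Lc j)) Lc ν t κ (toSite v) := by
  rw [← (Equiv.addLeft y).tsum_eq (fun y' : Site (d + 1) =>
    (((y' lam : ℤ) : ℝ) - ((y lam : ℤ) : ℝ)) * colH (coDressKBmAt ρ Lc (KInvStep (d := d) Lc j)) Lc ν y' κ ((Lc : ℤ) • y + toSite v))]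
  refine tsum_congr fun t => ?_
  have h := shiftK_coDressKBmAt_KInvStep (d := d) (Lc := Lc) ρ j y
  have h1 := congrFun (congrFun (congrFun (congrFun h ((Lc : ℤ) • y + toSite v)) ((Lc : ℤ) • (y + t))) (Sum.inl κ)) (Sum.inr ν)
  rw [shiftK] at h1
  have e : colH (coDressKBmAt ρ Lc (KInvStep (d := d) Lc j)) Lc ν (y + t) κ ((Lc : ℤ) • y + toSite v) =
      colH (coDressKBmAt ρ Lc (KInvStep (d := d) Lc j)) Lc ν t κ (toSite v) := by
    simp only [colH]; rw [← h1]
    congr 1 <;> [abel; (rw [smul_add]; abel)]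
  simp only [Equiv.coe_addLeft, Pi.add_apply, Int.cast_add, e]
  ring

omit [NeZero Lc] in
/-- [folklore] The multiplier twin: `Σ'_{y′} (y′−y)_λ·colM G_j Lc ν y′ ρ′ y = Σ'_t t_λ·colM G_j Lc ν t ρ′ 0`. -/
theorem tsum_slotMoment_colM_labelFree [NeZero Lc] (ρ : Fin (d + 1) → ℤ) (j : ℕ) (ν ρ' lam : Fin (d + 1)) (y : Site (d + 1)) :
    ∑' y' : Site (d + 1), (((y' lam : ℤ) : ℝ) - ((y lam : ℤ) : ℝ)) * colM (coDressKBmAt ρ Lc (KInvStep (d := d) Lc j)) Lc ν y' ρ' y =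
      ∑' t : Site (d + 1), ((t lam : ℤ) : ℝ) * colM (coDressKBmAt ρ Lc (KInvStep (d := d) Lc j)) Lc ν t ρ' 0 := by
  rw [← (Equiv.addLeft y).tsum_eq (fun y' : Site (d + 1) =>
    (((y' lam : ℤ) : ℝ) - ((y lam : ℤ) : ℝ)) * colM (coDressKBmAt ρ Lc (KInvStep (d := d) Lc j)) Lc ν y' ρ' y)]
  refine tsum_congr fun t => ?_
  have h := shiftK_coDressKBmAt_KInvStep (d := d) (Lc := Lc) ρ j y
  have h1 := congrFun (congrFun (congrFun (congrFun h ((Lc : ℤ) • y)) ((Lc : ℤ) • (y + t))) (Sum.inr ρ')) (Sum.inr ν)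
  rw [shiftK] at h1
  have e : colM (coDressKBmAt ρ Lc (KInvStep (d := d) Lc j)) Lc ν (y + t) ρ' y =
      colM (coDressKBmAt ρ Lc (KInvStep (d := d) Lc j)) Lc ν t ρ' 0 := by
    simp only [colM]; rw [← h1]
    congr 1 <;> [(rw [smul_zero]; abel); (rw [smul_add]; abel)]
  simp only [Equiv.coe_addLeft, Pi.add_apply, Int.cast_add, e]
  ring

/-- NOT IN PRINT; OUR BOOKKEEPING.  **THE SLOT-DIPOLE OF (α) IS LABEL-FREE** (idea-1 g35 (4.9): `π^{RV}_{ν;λ}(j+1) = −¼·[Σ_κ Σ_{ū∈B(0)} 𝔤^{FM}_{κν,λ}(ū)·T^{S}_κ(ū) + Σ_ρ′ 𝔤^{MM}_{ρ′ν,λ}·T_{ρ′}]`,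
`𝔤^{FM}_{κν,λ}(ū) := Σ'_t t_λ·colH G_{j+1} Lc ν t κ ū`, `𝔤^{MM}_{ρ′ν,λ} := Σ'_t t_λ·colM G_{j+1} Lc ν t ρ′ 0` — the FIRST MOMENTS OF ONE COARSE COLUMN, the only
`G`-dependent factors): the value of `WardResidualRotatedVertexDipole.hasSum_slotMoment_rotatedVertex_comb` at the label `y` EQUALS its value at the label `0`, written with the
in-box offsets `toSite v` — so the first slot-moment of (α)'s live charge is ONE number per `(ν; λ)`, channel and level, the same for every label block. -/
theorem hasSum_slotMoment_rotatedVertex_comb_labelFree (hLc : 1 ≤ Lc) {r : Fin (d + 1) → ℕ} (hr : r ∈ box (d + 1) Lc) (cE cVH cΛ : ℝ) (j : ℕ)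
    (y : Fin (d + 1) → ℤ) (ν lam : Fin (d + 1)) (a b : Fib d) :
    HasSum (fun y' : Site (d + 1) =>
        (((y' lam : ℤ) : ℝ) - ((y lam : ℤ) : ℝ)) *
          ((1 / 2 : ℝ) *
            ((∑ κ : Fin (d + 1), ∑' u : Site (d + 1),
                colH (coDressKBmAt (toSite r) Lc (KInvStep (d := d) Lc (j + 1))) Lc ν y' κ u
                  * ((if y' = y then (1 / 2 : ℝ) else 0) - (if blk Lc u = y then (1 / 2 : ℝ) else 0))
                  * ∑' xz : Site (d + 1) × Site (d + 1), SpureRecAt d Lc (toSite r) cE cVH cΛ (j + 1) κ u xz.1 xz.2 a b)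
              + ∑ ρ' : Fin (d + 1), ∑' w : Site (d + 1),
                colM (coDressKBmAt (toSite r) Lc (KInvStep (d := d) Lc (j + 1))) Lc ν y' ρ' w
                  * ((if y' = y then (1 / 2 : ℝ) else 0) - (if w = y then (1 / 2 : ℝ) else 0))
                  * ∑' xz : Site (d + 1) × Site (d + 1), M1At d Lc (toSite r) cΛ (j + 1) ρ' w xz.1 xz.2 a b)))
      (-(1 / 4 : ℝ) *
        ((∑ κ : Fin (d + 1), ∑ v ∈ box (d + 1) Lc,
            (∑' t : Site (d + 1), ((t lam : ℤ) : ℝ) * colH (coDressKBmAt (toSite r) Lc (KInvStep (d := d) Lc (j + 1))) Lc ν t κ (toSite v))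
              * ∑' xz : Site (d + 1) × Site (d + 1), SpureRecAt d Lc (toSite r) cE cVH cΛ (j + 1) κ (toSite v) xz.1 xz.2 a b)
          + ∑ ρ' : Fin (d + 1),
            (∑' t : Site (d + 1), ((t lam : ℤ) : ℝ) * colM (coDressKBmAt (toSite r) Lc (KInvStep (d := d) Lc (j + 1))) Lc ν t ρ' 0)
              * ∑' xz : Site (d + 1) × Site (d + 1), M1At d Lc (toSite r) cΛ (j + 1) ρ' 0 xz.1 xz.2 a b)) := by
  have h := WardResidualRotatedVertexDipole.hasSum_slotMoment_rotatedVertex_comb hLc hr cE cVH cΛ j y ν lam a b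
  have hS : ∀ (κ : Fin (d + 1)) (v : Fin (d + 1) → ℕ),
      (∑' xz : Site (d + 1) × Site (d + 1), SpureRecAt d Lc (toSite r) cE cVH cΛ (j + 1) κ ((Lc : ℤ) • y + toSite v) xz.1 xz.2 a b) =
      ∑' xz : Site (d + 1) × Site (d + 1), SpureRecAt d Lc (toSite r) cE cVH cΛ (j + 1) κ (toSite v) xz.1 xz.2 a b := by
    intro κ v
    have e := pairCharge_SpureRecAt_block (Lc := Lc) hLc (toSite r) cE cVH cΛ (j + 1) κ v 0 y a b
    rwa [smul_zero, zero_add] at e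
  have hM : ∀ ρ' : Fin (d + 1),
      (∑' xz : Site (d + 1) × Site (d + 1), M1At d Lc (toSite r) cΛ (j + 1) ρ' y xz.1 xz.2 a b) =
      ∑' xz : Site (d + 1) × Site (d + 1), M1At d Lc (toSite r) cΛ (j + 1) ρ' 0 xz.1 xz.2 a b :=
    fun ρ' => pairCharge_M1At_const (toSite r) cΛ (j + 1) ρ' y 0 a b
  simp only [tsum_slotMoment_colH_labelFree, tsum_slotMoment_colM_labelFree, hS, hM] at h
  exact h

end Summit.QuantumFields.BalabanUV.Beta.GAN24.WardResidualRotatedVertexMass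

end
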